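import Mathlib
import HarnessLib
import Literature.MathematicalPhysics.KineticTheory.VelocityFlipNoise
import Summits.AtomisticToContinuum.FouriersLaw.Theorems.VanishingNoiseTransferVanishingNoiseBoundFlipKuboOnsager

/-!
# The flip dissipation of the equilibrium forward field is at most `T²/γ − ⟨g, p_0² − T⟩_{μ_T}`

`--supports stmt-AtomisticToContinuum-11977` helper file (crux `VanishingNoiseTransfer.NoisyFourier`, route
`VanishingNoiseTransfer`, line `sector-dirichlet-gluing`, registered helper `helper_flipFieldDissipationLe` of
stub `stub_flipConductanceCeiling`).

Setting: the pinned anharmonic chain `pinnedChain ω₂ lam β γ` (all parameters `> 0`), `T > 0`, `L ≥ 2`, a flip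
rate `ε : ℝ` (no sign needed), and a classical forward field `g ∈ C² ∩ L²(μ_T)` of the flip-noisy equilibrium
generator, `(L_{T,T} + εS) g = −(p_0² − T)` pointwise (`S = flipNoise`, `F_i = momentumFlip i`). Write
`A = ⟨g, p_0² − T⟩_{μ_T}` and `E = Σ_i ‖g∘F_i − g‖²_{L²(μ_T)}` (the flip Dirichlet energy).

* `flipDissipation_le` — **`(ε/2) E ≤ T²/γ − A`**. As in the landed `flipKubo_pos_and_le`
  (file `…FlipKuboOnsager.lean`): `g` is an `ε = 0` forward PAIR for the modified source `k' = k_0 + εSg`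
  (`flip_forwardPair`), so fluctuation–dissipation reads `A = γT(‖∂_{p_0}g‖² + ‖∂_{p_{L−1}}g‖²) + (ε/2) E`
  (`integral_mul_flipNoise_self`); the Gaussian integration by parts `A = T⟨p_0, ∂_{p_0} g⟩_{μ_T}`
  (`integral_mul_sq_sub_gibbsMeasure`) and `2 p ∂g ≤ p²/γ + γ(∂g)²` give `A ≤ T²/(2γ) + (γT/2)‖∂_{p_0}g‖²`;
  combining, `(ε/2) E = A − γT‖∂_{p_0}g‖² − γT‖∂_{p_{L−1}}g‖² ≤ T²/γ − A`.
* `helper_flipFieldDissipationLe` — the registered helper (notation-free restatement).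

References: Bonetto–Lebowitz–Rey-Bellet 2000, eq. (32); Bernardin–Olla 2011 §2.1 (`S` symmetric, non-positive);
Eckmann–Pillet–Rey-Bellet 1999 §3; folklore (entropy production bound at linear response).
No definitions; axioms `propext`, `Classical.choice`, `Quot.sound` only.
-/

noncomputable section

open MeasureTheory Filter Topology
open scoped ContDiff
open Literature.MathematicalPhysics.KineticTheory.HeatConduction
open Summit.AtomisticToContinuum.FouriersLaw.Theorems.SuperadditiveResistance.DeviceLiouville
  (kin kin_eq_sq liouvilleOp bathOp)
open Summit.AtomisticToContinuum.FouriersLaw.Theorems.SuperadditiveResistance.Kubo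
  (termWeight termWeight_nonneg termWeight_pos sum_termWeight_mul memLp_partialP fluctuation_dissipation
    memLp_kinetic partition_pos)
open Summit.AtomisticToContinuum.FouriersLaw.Theorems.SuperadditiveResistance.KuboPlain
  (bathFin bathFin_zero bathFin_one bathFin_injective bathWeight_eq_termWeight)
open Summit.AtomisticToContinuum.FouriersLaw.Cruxes.SuperadditiveResistance.FloatingProbeBypassLaplacian
  (pinnedChain_memLp_two_snd pinnedChain_integral_snd_sq integral_mul_sq_sub_gibbsMeasure)
open Summit.AtomisticToContinuum.FouriersLaw.Theorems.VanishingNoiseBound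
  (flip_forwardPair gibbs_flipInvariant integral_mul_flipNoise_self memLp_flipNoise)

namespace Summit.AtomisticToContinuum.FouriersLaw.Theorems.NoisyFourier.FlipCeiling

section Dissipation

variable {ω₂ lam β γ : ℝ}

/-- **`(ε/2) Σ_i ‖g∘F_i − g‖²_{L²(μ_T)} ≤ T²/γ − ⟨g, p_0² − T⟩_{μ_T}`** — the flip dissipation of a classical
`C² ∩ L²(μ_T)` forward field `g` of the flip-noisy equilibrium generator, `(L_{T,T} + εS) g = −(p_0² − T)`
(`pinnedChain ω₂ lam β γ`, all `> 0`, `T > 0`, `L ≥ 2`, any `ε : ℝ`), is at most `T²/γ − A`. -/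
theorem flipDissipation_le (hω : 0 < ω₂) (hl : 0 < lam) (hβ : 0 < β) (hγ : 0 < γ) {T : ℝ} (hT : 0 < T)
    (ε : ℝ) {L : ℕ} (hL : 2 ≤ L) {g : PhaseSpace L → ℝ} (hg2 : ContDiff ℝ 2 g)
    (hgL : MemLp g 2 ((pinnedChain ω₂ lam β γ).gibbsMeasure L T))
    (hpde : ∀ x, (pinnedChain ω₂ lam β γ).flipGenerator L T T ε g x = -(kin L 0 x - T)) :
    ε / 2 * ∑ i : Fin L, ∫ x, (g (momentumFlip i x) - g x) ^ 2 ∂((pinnedChain ω₂ lam β γ).gibbsMeasure L T) ≤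
      T ^ 2 / γ - ∫ x, g x * (kin L 0 x - T) ∂((pinnedChain ω₂ lam β γ).gibbsMeasure L T) := by
  -- adapted from `VanishingNoiseBound.flipKubo_pos_and_le` (tree file `…FlipKuboOnsager.lean`), first half
  have hL1 : 1 ≤ L := by omega
  have hL0 : 0 < L := by omega
  set μ := (pinnedChain ω₂ lam β γ).gibbsMeasure L T with hμ
  haveI : IsProbabilityMeasure μ := pinnedChain_isProbabilityMeasure_gibbsMeasure hω hl.le hβ.le γ L hT
  have hflip := gibbs_flipInvariant (ω₂ := ω₂) (lam := lam) (β := β) (γ := γ) L T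
  set i0 : Fin L := ⟨0, hL0⟩ with hi0
  set i1 : Fin L := ⟨L - 1, by omega⟩ with hi1
  set s := bathFin L hL1 with hs_def
  have hs : Function.Injective s := bathFin_injective hL
  have hs0 : s 0 = i0 := bathFin_zero hL1
  have hs1 : s 1 = i1 := bathFin_one hL1
  have hBw : OscillatorChain.bathWeight L = termWeight s := bathWeight_eq_termWeight hL
  have hkin : ∀ x : PhaseSpace L, kin L 0 x = x.2 i0 ^ 2 := fun x => kin_eq_sq hL0 x
  -- the modified source `k' = k_0 + ε S g`
  set k' : PhaseSpace L → ℝ := fun x => (x.2 i0 ^ 2 - T) + ε * flipNoise L g x with hk'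
  have hpair : ∀ x, (1 : ℝ) * liouvilleOp (pinnedChain ω₂ lam β γ) L g x + γ * bathOp L (termWeight s) T g x =
      -k' x := by
    intro x
    rw [← hBw]
    have h := flip_forwardPair (ω₂ := ω₂) (lam := lam) (β := β) (γ := γ) L T ε
      (k := fun y => kin L 0 y - T) hpde x
    rw [h, hk', hkin x]
  have hk0L2 : MemLp (fun x : PhaseSpace L => x.2 i0 ^ 2 - T) 2 μ := memLp_kinetic (γ := γ) hω hl.le hβ.le L hT i0
  have hSgL2 : MemLp (flipNoise L g) 2 μ := memLp_flipNoise hflip hgL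
  have hk'L2 : MemLp k' 2 μ := hk0L2.add (hSgL2.const_mul ε)
  have hB0 : ∀ i, 0 ≤ termWeight s i := termWeight_nonneg s
  -- finite entropy production at the two contacts
  have hd0 : MemLp (partialP i0 g) 2 μ := by
    have h := memLp_partialP hω hl.le hβ.le γ L hT (termWeight s) hB0 1 hγ hg2 hgL hk'L2 hpair
      (i := s 0) (termWeight_pos s hs 0)
    rwa [hs0] at h
  have hd1 : MemLp (partialP i1 g) 2 μ := by
    have h := memLp_partialP hω hl.le hβ.le γ L hT (termWeight s) hB0 1 hγ hg2 hgL hk'L2 hpair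
      (i := s 1) (termWeight_pos s hs 1)
    rwa [hs1] at h
  -- fluctuation–dissipation in `μ_T` form: `∫ g k' dμ = γT(‖∂_0 g‖² + ‖∂_1 g‖²)`
  have hZ : 0 < ∫ x, (pinnedChain ω₂ lam β γ).gibbsDensity L T x := partition_pos hω hl.le hβ.le L hT
  set D0 : ℝ := ∫ x, partialP i0 g x ^ 2 ∂μ with hD0
  set D1 : ℝ := ∫ x, partialP i1 g x ^ 2 ∂μ with hD1
  have hD1n : 0 ≤ D1 := integral_nonneg fun x => sq_nonneg _
  have hFD : ∫ x, g x * k' x ∂μ = γ * T * (D0 + D1) := by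
    have h := fluctuation_dissipation hω hl.le hβ.le L hT (termWeight s) hB0 1 hγ hg2 hgL hk'L2 hpair
    rw [sum_termWeight_mul s, Fin.sum_univ_two, hs0, hs1] at h
    rw [(pinnedChain ω₂ lam β γ).integral_gibbsMeasure, h, hD0, hD1,
      (pinnedChain ω₂ lam β γ).integral_gibbsMeasure, (pinnedChain ω₂ lam β γ).integral_gibbsMeasure]
    field_simp
  -- the flip Dirichlet energy and the flip Dirichlet form `⟨g, Sg⟩ = −E/2`
  set E : ℝ := ∑ i, ∫ x, (g (momentumFlip i x) - g x) ^ 2 ∂μ with hE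
  have hgS : ∫ x, g x * flipNoise L g x ∂μ = -(1 / 2) * E := integral_mul_flipNoise_self hflip hgL
  -- `A = γT(D0 + D1) + (ε/2) E`
  set A : ℝ := ∫ x, g x * (kin L 0 x - T) ∂μ with hA
  have hAeq : A = γ * T * (D0 + D1) + ε / 2 * E := by
    have i1 : Integrable (fun x => g x * (x.2 i0 ^ 2 - T)) μ := hgL.integrable_mul hk0L2
    have i2 : Integrable (fun x => g x * flipNoise L g x) μ := hgL.integrable_mul hSgL2
    have e : (fun x => g x * k' x) = fun x => g x * (x.2 i0 ^ 2 - T) + ε * (g x * flipNoise L g x) := by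
      funext x; rw [hk']; ring
    have hA' : A = ∫ x, g x * (x.2 i0 ^ 2 - T) ∂μ := by
      rw [hA]; exact integral_congr_ae (ae_of_all _ fun x => by dsimp only; rw [hkin x])
    rw [e, integral_add i1 (i2.const_mul ε), integral_const_mul, hgS] at hFD
    rw [hA']
    linarith
  -- Gaussian integration by parts and `2 p ∂g ≤ p²/γ + γ(∂g)²`
  have hgd : Differentiable ℝ g := hg2.differentiable (by norm_num)
  have hIBP : ∫ x, g x * (x.2 i0 ^ 2 - T) ∂μ = T * ∫ x, partialP i0 g x * x.2 i0 ∂μ :=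
    integral_mul_sq_sub_gibbsMeasure hω hl.le hβ.le γ L hT i0 hgd hgL hd0
  have hp2 : ∫ x, x.2 i0 ^ 2 ∂μ = T := pinnedChain_integral_snd_sq hω hl.le hβ.le γ L hT i0
  have hpL2 : MemLp (fun x : PhaseSpace L => x.2 i0) 2 μ := pinnedChain_memLp_two_snd hω hl.le hβ.le γ L hT i0
  have hAMGM : ∫ x, partialP i0 g x * x.2 i0 ∂μ ≤ T / (2 * γ) + γ / 2 * D0 := by
    have i1 : Integrable (fun x => partialP i0 g x * x.2 i0) μ := hd0.integrable_mul hpL2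
    have i2 : Integrable (fun x : PhaseSpace L => x.2 i0 ^ 2) μ := hpL2.integrable_sq
    have i3 : Integrable (fun x => partialP i0 g x ^ 2) μ := hd0.integrable_sq
    have hle : ∀ x, partialP i0 g x * x.2 i0 ≤ (1 / (2 * γ)) * x.2 i0 ^ 2 + γ / 2 * partialP i0 g x ^ 2 := by
      intro x
      have h : 0 ≤ (x.2 i0 / γ - partialP i0 g x) ^ 2 := sq_nonneg _
      have e : (1 / (2 * γ)) * x.2 i0 ^ 2 + γ / 2 * partialP i0 g x ^ 2 - partialP i0 g x * x.2 i0 =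
          γ / 2 * (x.2 i0 / γ - partialP i0 g x) ^ 2 := by field_simp; ring
      nlinarith
    have i2' : Integrable (fun x : PhaseSpace L => (1 / (2 * γ)) * x.2 i0 ^ 2) μ := i2.const_mul (1 / (2 * γ))
    have i3' : Integrable (fun x => γ / 2 * partialP i0 g x ^ 2) μ := i3.const_mul (γ / 2)
    have i23 : Integrable (fun x => (1 / (2 * γ)) * x.2 i0 ^ 2 + γ / 2 * partialP i0 g x ^ 2) μ := i2'.add i3'
    calc ∫ x, partialP i0 g x * x.2 i0 ∂μ
        ≤ ∫ x, (1 / (2 * γ)) * x.2 i0 ^ 2 + γ / 2 * partialP i0 g x ^ 2 ∂μ := integral_mono i1 i23 hle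
      _ = (1 / (2 * γ)) * T + γ / 2 * D0 := by
          rw [integral_add i2' i3', integral_const_mul, integral_const_mul, hp2]
      _ = T / (2 * γ) + γ / 2 * D0 := by ring
  -- hence `A ≤ T²/(2γ) + (γT/2) D0`, and `(ε/2) E = A − γT D0 − γT D1 ≤ T²/γ − A`
  have hA' : A = T * ∫ x, partialP i0 g x * x.2 i0 ∂μ := by
    rw [hA, ← hIBP]; exact integral_congr_ae (ae_of_all _ fun x => by dsimp only; rw [hkin x])
  have h1 : A ≤ T * (T / (2 * γ) + γ / 2 * D0) := by
    rw [hA']; exact mul_le_mul_of_nonneg_left hAMGM hT.le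
  have h3 : T * (T / (2 * γ) + γ / 2 * D0) = (T ^ 2 / γ) / 2 + (γ * T * D0) / 2 := by
    field_simp
  rw [h3] at h1
  have hD1' : 0 ≤ γ * T * D1 := by positivity
  show ε / 2 * E ≤ T ^ 2 / γ - A
  linarith

end Dissipation

/-! ## Registered helper -/

/-- Registered helper sub-goal `helper_flipFieldDissipationLe` of stub `stub_flipConductanceCeiling` (line
`sector-dirichlet-gluing`, crux stmt-AtomisticToContinuum-11977): for every classical `C² ∩ L²(μ_T)` forward
field `g` of the flip-noisy equilibrium generator of `pinnedChain ω₂ lam β γ`, `(L_{T,T} + εS) g = −(p_0² − T)`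
(`L ≥ 2`, any `ε : ℝ`), the flip dissipation satisfies
`(ε/2) Σ_i ‖g∘F_i − g‖²_{L²(μ_T)} ≤ T²/γ − ⟨g, p_0² − T⟩_{μ_T}` (`flipDissipation_le`). -/
theorem helper_flipFieldDissipationLe : ∀ (ω₂ lam β γ T ε : ℝ), 0 < ω₂ → 0 < lam → 0 < β → 0 < γ → 0 < T → ∀ (L : ℕ), 2 ≤ L → ∀ g : Literature.MathematicalPhysics.KineticTheory.HeatConduction.PhaseSpace L → ℝ, ContDiff ℝ 2 g → MeasureTheory.MemLp g 2 ((Literature.MathematicalPhysics.KineticTheory.HeatConduction.pinnedChain ω₂ lam β γ).gibbsMeasure L T) → (∀ x, (Literature.MathematicalPhysics.KineticTheory.HeatConduction.pinnedChain ω₂ lam β γ).flipGenerator L T T ε g x = -(Summit.AtomisticToContinuum.FouriersLaw.Theorems.SuperadditiveResistance.DeviceLiouville.kin L 0 x - T)) → ε / 2 * ∑ i : Fin L, MeasureTheory.integral ((Literature.MathematicalPhysics.KineticTheory.HeatConduction.pinnedChain ω₂ lam β γ).gibbsMeasure L T) (fun x => (g (Literature.MathematicalPhysics.KineticTheory.HeatConduction.momentumFlip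 i x) - g x) ^ 2) ≤ T ^ 2 / γ - MeasureTheory.integral ((Literature.MathematicalPhysics.KineticTheory.HeatConduction.pinnedChain ω₂ lam β γ).gibbsMeasure L T) (fun x => g x * (Summit.AtomisticToContinuum.FouriersLaw.Theorems.SuperadditiveResistance.DeviceLiouville.kin L 0 x - T)) :=
  fun _ _ _ _ _ ε hω hl hβ hγ hT _ hL _ hg2 hgL hpde => flipDissipation_le hω hl hβ hγ hT ε hL hg2 hgL hpde

end Summit.AtomisticToContinuum.FouriersLaw.Theorems.NoisyFourier.FlipCeiling

end
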